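import Mathlib

/-!
# SoloBlind E55 — quotient chains: the signed cell quotients divide the modulus index

Solo programme `solo-Langlands-blind`, own line (O1b), s118 (tower theory §13.12).  With `A = T^new/(I₀, U_q − 1)` and `u = U_N`:
`ℤ/m_new = A/(u − N)`, `ℤ/M′₊₊ = A/(u − 1)`, `ℤ/M′₊₋ = A/(u + 1)`.  Since `u − N = (u − 1) − (N − 1) = (u + 1) − (N + 1)`, the ideal
`(u − N)` lies inside `(u − 1, N − 1)` and inside `(u + 1, N + 1)`, so `#A/(u − 1, N − 1)` and `#A/(u + 1, N + 1)` DIVIDE `#A/(u − N)`: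
`gcd(M′₊₊, N − 1) ∣ m_new` and `gcd(M′₊₋, N + 1) ∣ m_new` at every prime, including 2 where the cells do not split.
-/

set_option linter.dupNamespace false

namespace Summit.Langlands.Langlands.Theorems.SoloBlindQuotientChain

variable {R : Type*} [CommRing R]

/-- A larger ideal has a smaller quotient: `I ≤ J` implies `#(R ⧸ J) ∣ #(R ⧸ I)`. -/
theorem card_quotient_dvd_of_le (I J : Ideal R) (h : I ≤ J) : Nat.card (R ⧸ J) ∣ Nat.card (R ⧸ I) :=
  AddSubgroup.card_dvd_of_surjective ((Ideal.Quotient.factor h : R ⧸ I →+* R ⧸ J) : R ⧸ I →+ R ⧸ J)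
    (Ideal.Quotient.factor_surjective h)

/-- `(u − n) ⊆ (u − 1, n − 1)`. -/
theorem span_sub_le_minus (u n : R) : Ideal.span {u - n} ≤ Ideal.span {u - 1, n - 1} := by
  rw [Ideal.span_singleton_le_iff_mem]
  have e : u - n = (u - 1) - (n - 1) := by ring
  rw [e]
  exact Ideal.sub_mem _ (Ideal.subset_span (by simp)) (Ideal.subset_span (by simp))

/-- `(u − n) ⊆ (u + 1, n + 1)`. -/
theorem span_sub_le_plus (u n : R) : Ideal.span {u - n} ≤ Ideal.span {u + 1, n + 1} := by
  rw [Ideal.span_singleton_le_iff_mem]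
  have e : u - n = (u + 1) - (n + 1) := by ring
  rw [e]
  exact Ideal.sub_mem _ (Ideal.subset_span (by simp)) (Ideal.subset_span (by simp))

/-- QUOTIENT CHAIN (minus cell): `#R/(u − 1, n − 1) ∣ #R/(u − n)` — "gcd(M′₊₊, N−1) divides m_new". -/
theorem card_cell_minus_dvd (u n : R) :
    Nat.card (R ⧸ Ideal.span ({u - 1, n - 1} : Set R)) ∣ Nat.card (R ⧸ Ideal.span ({u - n} : Set R)) :=
  card_quotient_dvd_of_le _ _ (span_sub_le_minus u n)

/-- QUOTIENT CHAIN (plus cell): `#R/(u + 1, n + 1) ∣ #R/(u − n)` — "gcd(M′₊₋, N+1) divides m_new". -/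
theorem card_cell_plus_dvd (u n : R) :
    Nat.card (R ⧸ Ideal.span ({u + 1, n + 1} : Set R)) ∣ Nat.card (R ⧸ Ideal.span ({u - n} : Set R)) :=
  card_quotient_dvd_of_le _ _ (span_sub_le_plus u n)

end Summit.Langlands.Langlands.Theorems.SoloBlindQuotientChain
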